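import Summits.QuantumFields.YangMills.Theorems.ColdStartUniversalityLatticeLangevinDynkinForward
import Summits.QuantumFields.YangMills.Theorems.ColdStartUniversalityLatticeLangevinGeneratorCalculus
import Summits.QuantumFields.YangMills.Theorems.ColdStartUniversalityLatticeLangevinRegularFlow
import Summits.QuantumFields.YangMills.Theorems.ColdStartUniversalityColdStartSolutionsExistNoise
import HarnessLib

/-!
# Route `ColdStartUniversality`, crux K_A1 `UniformColdStartMixing` (stmt-QuantumFields-24809), rung `stub_fixedCutoffMixing`:
# (Inv) groundwork — the coordinate generator is tangential to the group

Helper file (seat `ym-line-csu-p1`, g7).  The coordinate generator of the SU(2) SZZ system (the integrand of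
`dynkin_expectation_szz`, whose drift contains the radial Itô correction `C_𝔤 Q_e`) nevertheless sees a test function only
through its restriction to the group: if two `C³` compactly supported functions of the link coordinates agree at all group
points then so do their generators (`generator_eq_of_eqOn_group`).  Proof: Dynkin's forward formula (`dynkin_forward`) along the
regular flow (`exists_regularFlow`) on the product Wiener space for the difference, whose expectation vanishes identically; the
continuous integrand of a vanishing primitive vanishes at `0`.  Used to transport generator identities from latitude
eigenfunctions to any smooth function with the same trace on the group (e.g. the plaquette function), step (c) of the (Inv) plan.
No definition, no sorry.  RECORD-rung R3 plumbing.
-/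

set_option autoImplicit false

noncomputable section

namespace Summit.QuantumFields.YangMills.Theorems.ColdStartUniversality

open MeasureTheory Finset Filter intervalIntegral
open scoped BigOperators Topology NNReal
open Literature.Probability.Process Literature.MathematicalPhysics.QuantumFieldTheory
open Literature.MathematicalPhysics.QuantumLattice (fundamentalRep fundamentalLatticeRep)

variable {L : ℕ} [NeZero L]

/-- A continuous function with vanishing primitive `∫₀^τ γ = 0` for all `τ ≥ 0` vanishes at `0`. [folklore] -/
theorem eq_zero_of_integral_eq_zero {γ : ℝ → ℝ} (hγ : Continuous γ) (h : ∀ τ : ℝ, 0 ≤ τ → ∫ r in (0 : ℝ)..τ, γ r = 0) :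
    γ 0 = 0 := by
  have hderiv : HasDerivAt (fun τ => ∫ r in (0 : ℝ)..τ, γ r) (γ 0) 0 :=
    intervalIntegral.integral_hasDerivAt_right (hγ.intervalIntegrable 0 0) (hγ.stronglyMeasurableAtFilter _ _) hγ.continuousAt
  -- the right derivative of the (identically zero on `[0,∞)`) primitive is `0`
  have hright : HasDerivWithinAt (fun τ => ∫ r in (0 : ℝ)..τ, γ r) (γ 0) (Set.Ici 0) 0 := hderiv.hasDerivWithinAt
  have hzero : HasDerivWithinAt (fun τ => ∫ r in (0 : ℝ)..τ, γ r) 0 (Set.Ici 0) 0 := by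
    refine (hasDerivWithinAt_const (0 : ℝ) (Set.Ici (0 : ℝ)) (0 : ℝ)).congr (fun τ hτ => h τ hτ) (h 0 le_rfl)
  have huniq := hright.mono_of_mem_nhdsWithin (self_mem_nhdsWithin)
  exact (uniqueDiffWithinAt_Ici 0).eq_deriv _ huniq hzero

/-- **The coordinate generator is tangential to `SU(2)^E`.**  If two `C³` compactly supported functions of the real link
coordinates agree at every group point, their SZZ coordinate generators (at any coupling `β`) agree at every group point.
[folklore] -/
theorem generator_eq_of_eqOn_group (β : ℝ) {f f' : (Edge 3 L × Fin 2 × Fin 2 × Bool → ℝ) → ℝ}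
    (hf : ContDiff ℝ 3 f) (hfc : HasCompactSupport f) (hf' : ContDiff ℝ 3 f') (hf'c : HasCompactSupport f')
    (heq : ∀ V : GaugeConfig 3 L (Matrix.specialUnitaryGroup (Fin 2) ℂ),
      f (fun q : Edge 3 L × Fin 2 × Fin 2 × Bool => (fun z : ℂ => if q.2.2.2 then z.im else z.re)
          ((fundamentalRep (Fin 2) (V q.1) : Matrix (Fin 2) (Fin 2) ℂ) q.2.1 q.2.2.1)) =
        f' (fun q : Edge 3 L × Fin 2 × Fin 2 × Bool => (fun z : ℂ => if q.2.2.2 then z.im else z.re)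
          ((fundamentalRep (Fin 2) (V q.1) : Matrix (Fin 2) (Fin 2) ℂ) q.2.1 q.2.2.1)))
    (V : GaugeConfig 3 L (Matrix.specialUnitaryGroup (Fin 2) ℂ)) :
    let x : (Edge 3 L × Fin 2 × Fin 2 × Bool) → ℝ := fun q =>
      (fun z : ℂ => if q.2.2.2 then z.im else z.re)
        ((fundamentalRep (Fin 2) (V q.1) : Matrix (Fin 2) (Fin 2) ℂ) q.2.1 q.2.2.1)
    let b : (Edge 3 L × Fin 2 × Fin 2 × Bool) → ℝ := fun q =>
      (fun z : ℂ => if q.2.2.2 then z.im else z.re) ((latticeLangevinDynamics (fundamentalLatticeRep 2) β).drift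
        (matrixConfig (fundamentalRep (Fin 2)) V) q.1 q.2.1 q.2.2.1)
    let σ : (Edge 3 L × Fin 2 × Fin 2 × Bool) → (Edge 3 L × NoiseIdx 2) → ℝ := fun q k =>
      if k.1 = q.1 then (fun z : ℂ => if q.2.2.2 then z.im else z.re)
        ((latticeLangevinDynamics (fundamentalLatticeRep 2) β).noise
          (matrixConfig (fundamentalRep (Fin 2)) V) q.1 k.2 q.2.1 q.2.2.1) else 0
    (∑ i, fderiv ℝ f x (Pi.single i 1) * b i +
      (1 / 2) * ∑ i, ∑ j, fderiv ℝ (fun z => fderiv ℝ f z (Pi.single i 1)) x (Pi.single j 1) * ∑ n, σ i n * σ j n) =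
    (∑ i, fderiv ℝ f' x (Pi.single i 1) * b i +
      (1 / 2) * ∑ i, ∑ j, fderiv ℝ (fun z => fderiv ℝ f' z (Pi.single i 1)) x (Pi.single j 1) * ∑ n, σ i n * σ j n) := by
  intro x b σ
  classical
  haveI := secondCountableTopology_su2
  haveI := borelSpace_config L
  -- the difference `g = f - f'` vanishes on the group
  set g : (Edge 3 L × Fin 2 × Fin 2 × Bool → ℝ) → ℝ := fun y => f y - f' y with hgdef
  have hg : ContDiff ℝ 3 g := hf.sub hf'
  have hgc : HasCompactSupport g := hfc.sub hf'c
  have hg0 : ∀ W : GaugeConfig 3 L (Matrix.specialUnitaryGroup (Fin 2) ℂ),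
      g (fun q : Edge 3 L × Fin 2 × Fin 2 × Bool => (fun z : ℂ => if q.2.2.2 then z.im else z.re)
          ((fundamentalRep (Fin 2) (W q.1) : Matrix (Fin 2) (Fin 2) ℂ) q.2.1 q.2.2.1)) = 0 := fun W => by
    simp only [hgdef, heq W, sub_self]
  -- linearity of the generator
  have hfd : Differentiable ℝ f := hf.differentiable (by norm_num)
  have hf'd : Differentiable ℝ f' := hf'.differentiable (by norm_num)
  have h1 : ∀ y v, fderiv ℝ g y v = fderiv ℝ f y v - fderiv ℝ f' y v := fun y v => by
    rw [hgdef, fderiv_fun_sub (hfd y) (hf'd y)]; rfl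
  have h2 : ∀ y v w, fderiv ℝ (fun z => fderiv ℝ g z v) y w =
      fderiv ℝ (fun z => fderiv ℝ f z v) y w - fderiv ℝ (fun z => fderiv ℝ f' z v) y w := by
    intro y v w
    have hfun : (fun z => fderiv ℝ g z v) = fun z => fderiv ℝ f z v - fderiv ℝ f' z v := by
      funext z; rw [hgdef, fderiv_fun_sub (hfd z) (hf'd z)]; rfl
    rw [hfun, fderiv_fun_sub (differentiableAt_fderiv_apply_const (hf.of_le (by norm_num)) y v)
      (differentiableAt_fderiv_apply_const (hf'.of_le (by norm_num)) y v)]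
    rfl
  -- Dynkin's forward formula for `g` along the regular flow on the product Wiener space
  haveI := isProbabilityMeasure_piWiener (Edge 3 L × NoiseIdx 2)
  have hWc := isFlatBrownian_piWiener 3 L (NoiseIdx 2)
  obtain ⟨U, G, hU, hUm, -, -, -⟩ := exists_regularFlow L β hWc
  obtain ⟨-, hcont, hDyn⟩ := dynkin_forward (L := L) β hWc U hU hUm V hg hgc
  -- the expectation of `g` vanishes identically, hence so does the primitive of `r ↦ E (𝓛g)(X_r)`
  have hprim : ∀ τ : ℝ, 0 ≤ τ → ∫ r in (0 : ℝ)..τ, ∫ ω, (∑ i : Edge 3 L × Fin 2 × Fin 2 × Bool, fderiv ℝ g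
      (fun q : Edge 3 L × Fin 2 × Fin 2 × Bool => (fun z : ℂ => if q.2.2.2 then z.im else z.re)
        ((fundamentalRep (Fin 2) (U V r.toNNReal ω q.1) : Matrix (Fin 2) (Fin 2) ℂ) q.2.1 q.2.2.1)) (Pi.single i 1) *
        (fun z : ℂ => if i.2.2.2 then z.im else z.re)
          ((latticeLangevinDynamics (fundamentalLatticeRep 2) β).drift
            (matrixConfig (fundamentalRep (Fin 2)) (U V r.toNNReal ω)) i.1 i.2.1 i.2.2.1) +
      1 / 2 * ∑ i : Edge 3 L × Fin 2 × Fin 2 × Bool, ∑ j : Edge 3 L × Fin 2 × Fin 2 × Bool,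
        fderiv ℝ (fun z => fderiv ℝ g z (Pi.single i 1))
          (fun q : Edge 3 L × Fin 2 × Fin 2 × Bool => (fun z : ℂ => if q.2.2.2 then z.im else z.re)
            ((fundamentalRep (Fin 2) (U V r.toNNReal ω q.1) : Matrix (Fin 2) (Fin 2) ℂ) q.2.1 q.2.2.1)) (Pi.single j 1) *
          ∑ n : Edge 3 L × NoiseIdx 2,
            (if n.1 = i.1 then (fun z : ℂ => if i.2.2.2 then z.im else z.re)
              ((latticeLangevinDynamics (fundamentalLatticeRep 2) β).noise
                (matrixConfig (fundamentalRep (Fin 2)) (U V r.toNNReal ω)) i.1 n.2 i.2.1 i.2.2.1) else 0) *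
            (if n.1 = j.1 then (fun z : ℂ => if j.2.2.2 then z.im else z.re)
              ((latticeLangevinDynamics (fundamentalLatticeRep 2) β).noise
                (matrixConfig (fundamentalRep (Fin 2)) (U V r.toNNReal ω)) j.1 n.2 j.2.1 j.2.2.1) else 0))
      ∂(Measure.pi fun _ : Edge 3 L × NoiseIdx 2 => preWienerMeasure) = 0 := by
    intro τ hτ
    have h := hDyn τ hτ
    simp only [hg0, integral_zero, zero_add] at h
    exact h.symm
  have hγ0 := eq_zero_of_integral_eq_zero hcont hprim
  -- at `r = 0` the flow sits at `V`
  simp only [Real.toNNReal_zero, (hU V).1, MeasureTheory.integral_const, smul_eq_mul, probReal_univ, one_mul] at hγ0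
  -- the generator of `g` at `V` vanishes
  have hgen_g : (∑ i, fderiv ℝ g x (Pi.single i 1) * b i +
      (1 / 2) * ∑ i, ∑ j, fderiv ℝ (fun z => fderiv ℝ g z (Pi.single i 1)) x (Pi.single j 1) * ∑ n, σ i n * σ j n) = 0 :=
    hγ0
  -- conclude by linearity
  simp only [h2] at hgen_g
  simp only [h1] at hgen_g
  have hsplit : (∑ i, (fderiv ℝ f x (Pi.single i 1) - fderiv ℝ f' x (Pi.single i 1)) * b i +
      1 / 2 * ∑ i, ∑ j, (fderiv ℝ (fun z => fderiv ℝ f z (Pi.single i 1)) x (Pi.single j 1) -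
        fderiv ℝ (fun z => fderiv ℝ f' z (Pi.single i 1)) x (Pi.single j 1)) * ∑ n, σ i n * σ j n) =
      (∑ i, fderiv ℝ f x (Pi.single i 1) * b i +
        (1 / 2) * ∑ i, ∑ j, fderiv ℝ (fun z => fderiv ℝ f z (Pi.single i 1)) x (Pi.single j 1) * ∑ n, σ i n * σ j n) -
      (∑ i, fderiv ℝ f' x (Pi.single i 1) * b i +
        (1 / 2) * ∑ i, ∑ j, fderiv ℝ (fun z => fderiv ℝ f' z (Pi.single i 1)) x (Pi.single j 1) * ∑ n, σ i n * σ j n) := by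
    simp only [sub_mul, Finset.sum_sub_distrib, mul_sub]
    ring
  rw [hsplit] at hgen_g
  exact sub_eq_zero.1 hgen_g

end Summit.QuantumFields.YangMills.Theorems.ColdStartUniversality

end
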